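import Summits.CriticalPhenomena.PercolationContinuityZ3.Theorems.PercNearOneGluingNoHeavyConstsClusterSquareNDCPos
import HarnessLib

/-!
# A `b`-clash forces an accessible branch vertex; no double clash when branch vertices are separated

builds on p205010 (kernel theorem, internal audit signed; external expert review pending)

PAPER-2 track "percolation constants", part (ii), seat `prim-consts-1`, gen 17 (lane index
`run/shared/lean/prim/consts/CONSTANTS.md`, row A19; memo `FROM-prim-consts-1-g17-THREE-COPY-STRUCTURE.md` §2).
Support file for the crux `NoHeavyLowerTail` (stmt-CriticalPhenomena-4575; `--supports`).  Theorems only; no sorries.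

A combinatorial criterion for the no-double-clash hypothesis of `…ConstsClusterSquareNDCPos.lean`, subsuming
`…ConstsClusterSquareNDC.lean` (at most four vertices) and `…ConstsClusterSquareThin.lean` (a thinly attached terminal).
Terminology (relative to a graph `H` carrying all pairs of positive weight and the terminals `a, b, c`): a *branch vertex* is a
vertex outside `{a, b, c}` with at least three neighbours; a set of vertices is *closed off `A`* if it is closed under `H`-steps into
vertices outside `A`; `R_t` denotes any set containing `t` and closed off `{a, b, c}`.
**A `b`-clash forces a branch vertex `v ∈ R_a ∩ R_b ∩ R_c` joined to `b` in `ω` and to `c` in `η'`**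
(`Consts.exists_branch_of_clash`): the `η'`-path `Q` from the clash vertex `y` to `c` (inside `C_c(η')`, avoiding `K ∪ {b}`) must
leave the `ω`-path `P` from `y` to `b` (inside `C_b(ω)`, avoiding `K ∪ {c}`) at a vertex `v ≠ b` of `P`; `v` has three distinct
neighbours (its predecessor on `P` or in `K`, its successor on `P`, the exit vertex), lies on `P` and on `Q`, and is reached through
vertices outside `{a, b, c}` from `b` (backwards along `P`), from `c` (backwards along `Q`) and from `a` (through `K`, the pair
`{k, y}` and `P`).  Symmetrically a `c`-clash forces a branch vertex `v' ∈ R_a ∩ R_b ∩ R_c` joined to `c` in `ω` and to `b` in `η'`;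
as `b ↮ c` in both configurations, `v ≠ v'`, the `ω`-path from `v` to `b` avoids `{a, c, v'}`, the `η'`-path from `v` to `c` avoids
`{a, b, v'}`, and likewise for `v'`.  Hence (`Consts.not_doubleClash_of_separated`) **no double clash occurs if for every ordered pair
of distinct branch vertices `v, v' ∈ R_a ∩ R_b ∩ R_c` one of the four separations holds: `v ∤ b` off `{a, c, v'}`, `v ∤ c` off
`{a, b, v'}`, `v' ∤ c` off `{a, b, v}`, `v' ∤ b` off `{a, c, v}`** — each certified by a closed set containing the one vertex and not
the other.  CSQ, DUU at `(a; b, c)` and TS for `{a, b, c}` follow (`Consts.clusterSquare_le_sq_of_separated`, `…_of_separated`), in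
particular when `R_a ∩ R_b ∩ R_c` has at most one branch vertex (`…_of_oneBranch`) and when at most one vertex outside `{a, b, c}`
has three or more neighbours at all (`Consts.tripleSplit_of_atMostOneBranch`; contains `n ≤ 4` and "degree ≤ 2 outside the
terminals").  Exhaustive check (lane engine `eng/branch_crit.py`): the criterion holds for 19 770 of the 20 010 rooted graphs on five
vertices with at most seven edges satisfying NDC, and for none violating it.
Reference: N. Gladkov, arXiv:2408.08457v2 (2024), Thm. 4.3, Def. 4.2, Lemma 3.1, Example 2.5, Thm. 5.2.
-/

noncomputable section

open Classical

namespace Summit.CriticalPhenomena.PercolationContinuityZ3.Theorems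

open MeasureTheory Finset Literature.Probability.LatticeModels Literature.Probability.Percolation
open Literature.Probability.Percolation.DecisionTree Literature.Probability.Percolation.BHK2006
open Literature.Probability.Percolation.TargetExploration Literature.Probability.Percolation.ClusterConditioning

namespace Consts

section General

variable {V : Type*} [Fintype V]

omit [Fintype V] in
/-- A set `S` closed under `H`-steps into admissible vertices contains the endpoint of every open walk which starts in `S` and all of
whose vertices lie in `S` or are admissible. [folklore] -/
theorem mem_of_openWalk_adm (H : SimpleGraph V) {ω : Set (Sym2 V)} (S : Set V) (adm : V → Prop)
    (hS : ∀ u x, u ∈ S → H.Adj u x → adm x → x ∈ S) (hωH : ∀ u v, (openGraph ω).Adj u v → H.Adj u v)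
    {u v : V} (W : (openGraph ω).Walk u v) (hu : u ∈ S) (hW : ∀ x ∈ W.support, x ∈ S ∨ adm x) : v ∈ S := by
  induction W with
  | nil => exact hu
  | @cons u x v h W ih =>
    have hx : x ∈ S := by
      rcases hW x (by simp) with hx | hx
      · exact hx
      · exact hS u x hu (hωH u x h) hx
    exact ih hx fun z hz => hW z (by simp [hz])

/-- **A `b`-clash forces a branch vertex of `R_a ∩ R_b ∩ R_c` joined to `b` in `ω` and to `c` in `θ`.**  `H` a graph; `Ra ∋ a`,
`Rb ∋ b`, `Rc ∋ c` closed under `H`-steps into vertices outside `{a, b, c}`; `ω` a configuration of `H`-edges with `a ↮ b`, `a ↮ c`,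
`b ↮ c`; `θ` a configuration of `H`-edges none of which meets the `ω`-cluster `K` of `a`, with `b ↮ c` in `θ`.  If `y` has an
`H`-neighbour in `K` and is joined to `b` in `ω` and to `c` in `θ`, then some `v ∈ Ra ∩ Rb ∩ Rc` outside `{a, b, c}` has at least
three `H`-neighbours and is joined to `b` in `ω` and to `c` in `θ`. [folklore; combinatorial input for Gladkov2024, Thm. 4.3 / Ex. 2.5] -/
theorem exists_branch_of_clash (H : SimpleGraph V) [DecidableRel H.Adj] {a b c k y : V} {ω θ : Set (Sym2 V)}
    (Ra Rb Rc : Set V) (haR : a ∈ Ra) (hRa : ∀ u v, u ∈ Ra → H.Adj u v → v ≠ a → v ≠ b → v ≠ c → v ∈ Ra)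
    (hbR : b ∈ Rb) (hRb : ∀ u v, u ∈ Rb → H.Adj u v → v ≠ a → v ≠ b → v ≠ c → v ∈ Rb)
    (hcR : c ∈ Rc) (hRc : ∀ u v, u ∈ Rc → H.Adj u v → v ≠ a → v ≠ b → v ≠ c → v ∈ Rc)
    (hωH : ∀ u v, (openGraph ω).Adj u v → H.Adj u v) (hθH : ∀ u v, (openGraph θ).Adj u v → H.Adj u v)
    (hθK : ∀ u v, (openGraph θ).Adj u v → ¬ (openGraph ω).Reachable a v)
    (hab : ¬ (openGraph ω).Reachable a b) (hac : ¬ (openGraph ω).Reachable a c) (hbc : ¬ (openGraph ω).Reachable b c)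
    (hbc' : ¬ (openGraph θ).Reachable b c)
    (hk : (openGraph ω).Reachable a k) (hky : H.Adj k y) (hby : (openGraph ω).Reachable b y)
    (hcy : (openGraph θ).Reachable c y) :
    ∃ v, v ∈ Ra ∧ v ∈ Rb ∧ v ∈ Rc ∧ v ≠ a ∧ v ≠ b ∧ v ≠ c ∧ 3 ≤ H.degree v ∧ (openGraph ω).Reachable b v ∧
      (openGraph θ).Reachable c v := by
  obtain ⟨P₀⟩ := hby.symm
  obtain ⟨Q⟩ := hcy.symm
  set P := P₀.bypass with hPdef
  have hP : P.IsPath := P₀.bypass_isPath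
  -- the vertices of `P` other than its endpoint `b`
  set S : Set V := {v | ∃ i, i < P.length ∧ P.getVert i = v} with hSdef
  have hreachP : ∀ i, (openGraph ω).Reachable y (P.getVert i) := fun i => ⟨P.takeUntil _ (P.getVert_mem_support i)⟩
  have hreachQ : ∀ x ∈ Q.support, (openGraph θ).Reachable y x := fun x hx => ⟨Q.takeUntil x hx⟩
  have hyb : y ≠ b := by rintro rfl; exact hbc' hcy.symm
  have hlen : 0 < P.length := by
    by_contra h0
    have h0' : P.length = 0 := by omega
    have := P.getVert_length
    rw [h0', P.getVert_zero] at this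
    exact hyb this
  have hyS : y ∈ S := ⟨0, hlen, P.getVert_zero⟩
  have hcS : c ∉ S := by
    rintro ⟨i, -, hi⟩
    exact hbc (hby.trans (hi ▸ hreachP i))
  have hPi_notK : ∀ j, ¬ (openGraph ω).Reachable a (P.getVert j) := fun j h =>
    hab (h.trans ((hreachP j).symm.trans hby.symm))
  have hPi_ne_b : ∀ j, j < P.length → P.getVert j ≠ b := by
    intro j hj h
    have := hP.getVert_injOn (by simp only [Set.mem_setOf_eq]; omega) (by simp only [Set.mem_setOf_eq]; exact le_rfl)
      (h.trans P.getVert_length.symm)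
    omega
  -- no vertex of `Q` lies in `K`
  have hQ_notK : ∀ x ∈ Q.support, ¬ (openGraph ω).Reachable a x := by
    intro x hx
    rcases SimpleGraph.Walk.mem_support_iff_exists_mem_edges.1 hx with rfl | ⟨e, he, hxe⟩
    · exact hac
    · have key : ∀ e : Sym2 V, e ∈ (openGraph θ).edgeSet → x ∈ e → ¬ (openGraph ω).Reachable a x := by
        intro e
        induction e using Sym2.ind with
        | h p q =>
          intro hpq hxe
          rw [SimpleGraph.mem_edgeSet] at hpq
          rcases Sym2.mem_iff.1 hxe with rfl | rfl
          exacts [hθK q _ hpq.symm, hθK p _ hpq]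
      exact key e (Q.edges_subset_edgeSet he) hxe
  -- `K ⊆ Ra`, hence `y ∈ Ra`, hence every vertex of `P` before `b` lies in `Ra` (walk forward from `y`)
  have hkR : k ∈ Ra := by
    obtain ⟨W⟩ := id hk
    refine mem_of_openWalk_adm H Ra (fun x => x ≠ a ∧ x ≠ b ∧ x ≠ c) (fun u x hu hux hx => hRa u x hu hux hx.1 hx.2.1 hx.2.2)
      hωH W haR fun x hx => ?_
    have hax : (openGraph ω).Reachable a x := ⟨W.takeUntil x hx⟩
    by_cases hxa : x = a
    · exact Or.inl (hxa ▸ haR)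
    · exact Or.inr ⟨hxa, fun h => hab (h ▸ hax), fun h => hac (h ▸ hax)⟩
  have hyR : y ∈ Ra := hRa k y hkR hky (fun h => hab (by rw [← h]; exact hby.symm))
    (fun h => hbc' (by rw [← h]; exact hcy.symm)) fun h => hbc (by rw [← h]; exact hby)
  have hPRa : ∀ j, j < P.length → P.getVert j ∈ Ra := by
    intro j hj
    induction j with
    | zero => rw [P.getVert_zero]; exact hyR
    | succ j ih =>
      exact hRa _ _ (ih (by omega)) (hωH _ _ (P.adj_getVert_succ (show j < P.length by omega)))
        (fun h => hPi_notK (j + 1) (by rw [h])) (hPi_ne_b _ hj) (fun h => hcS ⟨_, hj, h⟩)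
  -- every vertex of `P` lies in `Rb` (walk back from `b`)
  have hPRb : ∀ j, j < P.length → P.getVert j ∈ Rb := by
    have hback : ∀ j, j ≤ P.length → P.getVert (P.length - j) ∈ Rb := by
      intro j hj
      induction j with
      | zero => rw [Nat.sub_zero, P.getVert_length]; exact hbR
      | succ j ih =>
        have hlt : P.length - (j + 1) < P.length := by omega
        have hadj := hωH _ _ (P.adj_getVert_succ hlt)
        rw [show P.length - (j + 1) + 1 = P.length - j from by omega] at hadj
        exact hRb _ _ (ih (by omega)) hadj.symm (fun h => hPi_notK (P.length - (j + 1)) (by rw [h]))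
          (hPi_ne_b _ hlt) (fun h => hcS ⟨_, hlt, h⟩)
    intro j hj
    have := hback (P.length - j) (by omega)
    rwa [show P.length - (P.length - j) = j from by omega] at this
  -- the `θ`-path from `y` to `c` leaves `S` through a dart `d`; `d.fst = P i`
  obtain ⟨d, hd, hdS, hdS'⟩ := Q.exists_boundary_dart S hyS hcS
  obtain ⟨i, hi, hiv⟩ := hdS
  have hfst_mem : d.fst ∈ Q.support := Q.dart_fst_mem_support_of_mem_darts hd
  have hsnd_reach : (openGraph θ).Reachable y d.snd := hreachQ _ (Q.dart_snd_mem_support_of_mem_darts hd)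
  have hsnd_ne_b : d.snd ≠ b := by
    intro h; rw [h] at hsnd_reach; exact hbc' (hsnd_reach.symm.trans hcy.symm)
  have hsnd_K : ¬ (openGraph ω).Reachable a d.snd := hθK _ _ d.adj
  have hadj_snd : H.Adj (P.getVert i) d.snd := hiv ▸ hθH _ _ d.adj
  have hadj_succ : H.Adj (P.getVert i) (P.getVert (i + 1)) := hωH _ _ (P.adj_getVert_succ hi)
  have hsucc_ne_snd : P.getVert (i + 1) ≠ d.snd := by
    intro h
    by_cases hi1 : i + 1 < P.length
    · exact hdS' ⟨i + 1, hi1, h⟩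
    · have hi1' : i + 1 = P.length := by omega
      rw [hi1', P.getVert_length] at h
      exact hsnd_ne_b h.symm
  -- the predecessor of `P i`: `k` if `i = 0`, else `P (i - 1)`
  obtain ⟨u, hadj_pred, hpred_ne_snd, hpred_ne_succ⟩ :
      ∃ u, H.Adj (P.getVert i) u ∧ u ≠ d.snd ∧ u ≠ P.getVert (i + 1) := by
    by_cases hi0 : i = 0
    · subst hi0
      refine ⟨k, by rw [P.getVert_zero]; exact hky.symm, fun h => hsnd_K (h ▸ hk), fun h => hPi_notK 1 (h ▸ hk)⟩
    · refine ⟨P.getVert (i - 1), ?_, fun h => hdS' ⟨i - 1, by omega, h⟩, fun h => ?_⟩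
      · have h := hωH _ _ (P.adj_getVert_succ (show i - 1 < P.length by omega))
        rw [show i - 1 + 1 = i from by omega] at h
        exact h.symm
      · have := hP.getVert_injOn (by simp only [Set.mem_setOf_eq]; omega) (by simp only [Set.mem_setOf_eq]; omega) h
        omega
  have h3 : ({u, P.getVert (i + 1), d.snd} : Finset V) ⊆ H.neighborFinset (P.getVert i) := by
    intro x hx
    simp only [Finset.mem_insert, Finset.mem_singleton] at hx
    rw [SimpleGraph.mem_neighborFinset]
    rcases hx with rfl | rfl | rfl
    exacts [hadj_pred, hadj_succ, hadj_snd]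
  have hcard : ({u, P.getVert (i + 1), d.snd} : Finset V).card = 3 := by
    rw [Finset.card_eq_three]
    exact ⟨u, P.getVert (i + 1), d.snd, hpred_ne_succ, hpred_ne_snd, hsucc_ne_snd, rfl⟩
  -- `P i = d.fst` lies on `Q`, hence is joined to `c` in `θ` and belongs to `Rc` (walk back from `c` along `Q`)
  have hcv : (openGraph θ).Reachable c (P.getVert i) := hcy.trans (hiv ▸ hreachQ _ hfst_mem)
  have hvRc : P.getVert i ∈ Rc := by
    rw [hiv]
    refine mem_of_openWalk_adm H Rc (fun x => x ≠ a ∧ x ≠ b ∧ x ≠ c) (fun u x hu hux hx => hRc u x hu hux hx.1 hx.2.1 hx.2.2)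
      hθH (Q.dropUntil d.fst hfst_mem).reverse hcR fun x hx => ?_
    have hxQ : x ∈ Q.support := by
      rw [SimpleGraph.Walk.support_reverse, List.mem_reverse] at hx
      exact Q.support_dropUntil_subset_support hfst_mem hx
    by_cases hxc : x = c
    · exact Or.inl (hxc ▸ hcR)
    · exact Or.inr ⟨fun h => hQ_notK x hxQ (by rw [h]), fun h => hbc' (by rw [← h]; exact (hreachQ x hxQ).symm.trans hcy.symm),
        hxc⟩
  refine ⟨P.getVert i, hPRa i hi, hPRb i hi, hvRc, fun h => hPi_notK i (by rw [h]), hPi_ne_b i hi, fun h => hcS ⟨i, hi, h⟩,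
    ?_, hby.trans (hreachP i), hcv⟩
  rw [← SimpleGraph.card_neighborFinset_eq_degree, ← hcard]
  exact Finset.card_le_card h3

/-- **No double clash when every pair of branch vertices is separated.**  `Ra ∋ a`, `Rb ∋ b`, `Rc ∋ c` closed under `H`-steps into
vertices outside `{a, b, c}` (`H` carrying all pairs of positive weight).  Suppose that for every ordered pair of distinct vertices
`v, v' ∈ Ra ∩ Rb ∩ Rc` outside `{a, b, c}` with at least three neighbours each, some set `S` certifies one of: `v ∈ S ∌ b`, `S` closed
under steps into vertices outside `{a, c, v'}`; `v ∈ S ∌ c`, `S` closed off `{a, b, v'}`; `v' ∈ S ∌ c`, `S` closed off `{a, b, v}`;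
`v' ∈ S ∌ b`, `S` closed off `{a, c, v}`.  Then the no-double-clash hypothesis of `Consts.clusterSquare_le_sq_of_noDoubleClash_pos`
holds for every pair of configurations of positive pairs. [folklore; input for Gladkov2024, Thm. 4.3] -/
theorem not_doubleClash_of_separated (H : SimpleGraph V) [DecidableRel H.Adj] (w : Sym2 V → unitInterval) {a b c : V}
    (hH : ∀ u v, u ≠ v → (0 : ℝ) < w s(u, v) → H.Adj u v) (Ra Rb Rc : Set V) (haR : a ∈ Ra) (hbR : b ∈ Rb) (hcR : c ∈ Rc)
    (hRa : ∀ u v, u ∈ Ra → H.Adj u v → v ≠ a → v ≠ b → v ≠ c → v ∈ Ra)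
    (hRb : ∀ u v, u ∈ Rb → H.Adj u v → v ≠ a → v ≠ b → v ≠ c → v ∈ Rb)
    (hRc : ∀ u v, u ∈ Rc → H.Adj u v → v ≠ a → v ≠ b → v ≠ c → v ∈ Rc)
    (hsep : ∀ v v', v ∈ Ra → v ∈ Rb → v ∈ Rc → v' ∈ Ra → v' ∈ Rb → v' ∈ Rc → v ≠ a → v ≠ b → v ≠ c →
      v' ≠ a → v' ≠ b → v' ≠ c → v ≠ v' → 3 ≤ H.degree v → 3 ≤ H.degree v' → ∃ S : Set V,
        (v ∈ S ∧ b ∉ S ∧ ∀ u x, u ∈ S → H.Adj u x → x ≠ a → x ≠ c → x ≠ v' → x ∈ S) ∨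
        (v ∈ S ∧ c ∉ S ∧ ∀ u x, u ∈ S → H.Adj u x → x ≠ a → x ≠ b → x ≠ v' → x ∈ S) ∨
        (v' ∈ S ∧ c ∉ S ∧ ∀ u x, u ∈ S → H.Adj u x → x ≠ a → x ≠ b → x ≠ v → x ∈ S) ∨
        (v' ∈ S ∧ b ∉ S ∧ ∀ u x, u ∈ S → H.Adj u x → x ≠ a → x ≠ c → x ≠ v → x ∈ S))
    {ω η : Set (Sym2 V)} (hω : ∀ e ∈ ω, (0 : ℝ) < w e) (hη : ∀ e ∈ η, (0 : ℝ) < w e)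
    (hab : ¬ (openGraph ω).Reachable a b) (hac : ¬ (openGraph ω).Reachable a c) (hbc : ¬ (openGraph ω).Reachable b c)
    (hbc' : ¬ (openGraph (η \ barOf {a} (setCl ω {a}))).Reachable b c) :
    ¬ ((∃ y k : V, (openGraph ω).Reachable a k ∧ (0 : ℝ) < w s(k, y) ∧ (openGraph ω).Reachable b y ∧
          (openGraph (η \ barOf {a} (setCl ω {a}))).Reachable c y) ∧
       (∃ y k : V, (openGraph ω).Reachable a k ∧ (0 : ℝ) < w s(k, y) ∧ (openGraph ω).Reachable c y ∧
          (openGraph (η \ barOf {a} (setCl ω {a}))).Reachable b y)) := by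
  rintro ⟨⟨y, k, hk, hw, hby, hcy⟩, ⟨y', k', hk', hw', hcy', hby'⟩⟩
  set θ := η \ barOf {a} (setCl ω {a}) with hθdef
  have hadjH : ∀ (ξ : Set (Sym2 V)), (∀ e ∈ ξ, (0 : ℝ) < w e) → ∀ u v, (openGraph ξ).Adj u v → H.Adj u v := by
    intro ξ hξ u v huv
    rw [openGraph_adj] at huv
    exact hH u v huv.2 (hξ _ huv.1)
  have hθ : ∀ e ∈ θ, (0 : ℝ) < w e := fun e he => hη e he.1
  have hθK : ∀ u v, (openGraph θ).Adj u v → ¬ (openGraph ω).Reachable a v := by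
    intro u v huv hav
    rw [openGraph_adj, hθdef, barOf_setCl_singleton_eq_cutSet] at huv
    exact huv.1.2 ⟨v, Sym2.mem_mk_right u v, hav⟩
  -- `a` is isolated in `θ`
  have hθa : ∀ x, (openGraph θ).Reachable a x → x = a := by
    rintro x ⟨W⟩
    cases W with
    | nil => rfl
    | cons h W' => exact absurd (SimpleGraph.Reachable.refl a) (hθK _ _ h.symm)
  have hky : H.Adj k y := hH k y (fun h => hab (hk.trans (h ▸ hby.symm))) hw
  have hky' : H.Adj k' y' := hH k' y' (fun h => hac (hk'.trans (h ▸ hcy'.symm))) hw'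
  obtain ⟨v, hvRa, hvRb, hvRc, hva, hvb, hvc, hdv, hbv, hcv⟩ := exists_branch_of_clash H Ra Rb Rc haR hRa hbR hRb hcR hRc
    (hadjH ω hω) (hadjH _ hθ) hθK hab hac hbc hbc' hk hky hby hcy
  obtain ⟨v', hvRa', hvRc', hvRb', hva', hvc', hvb', hdv', hcv', hbv'⟩ := exists_branch_of_clash H Ra Rc Rb haR
    (fun u x hu hux hxa hxc hxb => hRa u x hu hux hxa hxb hxc) hcR (fun u x hu hux hxa hxc hxb => hRc u x hu hux hxa hxb hxc)
    hbR (fun u x hu hux hxa hxc hxb => hRb u x hu hux hxa hxb hxc)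
    (hadjH ω hω) (hadjH _ hθ) hθK hac hab (fun h => hbc h.symm) (fun h => hbc' h.symm) hk' hky' hcy' hby'
  have hne : v ≠ v' := by
    rintro rfl
    exact hbc (hbv.trans hcv'.symm)
  -- the four kinds of joining walks and what their vertices avoid
  have hωwalk : ∀ {s t : V} (W : (openGraph ω).Walk s t) (x : V), x ∈ W.support → (openGraph ω).Reachable s x :=
    fun W x hx => ⟨W.takeUntil x hx⟩
  have hθwalk : ∀ {s t : V} (W : (openGraph θ).Walk s t) (x : V), x ∈ W.support → (openGraph θ).Reachable s x :=
    fun W x hx => ⟨W.takeUntil x hx⟩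
  obtain ⟨S, hS⟩ := hsep v v' hvRa hvRb hvRc hvRa' hvRb' hvRc' hva hvb hvc hva' hvb' hvc' hne hdv hdv'
  rcases hS with ⟨hvS, hbS, hcl⟩ | ⟨hvS, hcS, hcl⟩ | ⟨hvS, hcS, hcl⟩ | ⟨hvS, hbS, hcl⟩
  · -- `v ∤ b` off `{a, c, v'}`: contradicted by the `ω`-walk from `v` to `b` inside `C_b(ω)`
    obtain ⟨W⟩ := hbv.symm
    refine hbS (mem_of_openWalk_adm H S (fun x => x ≠ a ∧ x ≠ c ∧ x ≠ v')
      (fun u x hu hux hx => hcl u x hu hux hx.1 hx.2.1 hx.2.2) (hadjH ω hω) W hvS fun x hx => Or.inr ?_)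
    have hbx : (openGraph ω).Reachable b x := hbv.trans (hωwalk W x hx)
    exact ⟨fun h => hab (by rw [← h]; exact hbx.symm), fun h => hbc (by rw [← h]; exact hbx),
      fun h => hbc (hbx.trans (by rw [h]; exact hcv'.symm))⟩
  · -- `v ∤ c` off `{a, b, v'}`: contradicted by the `θ`-walk from `v` to `c` inside `C_c(θ)`
    obtain ⟨W⟩ := hcv.symm
    refine hcS (mem_of_openWalk_adm H S (fun x => x ≠ a ∧ x ≠ b ∧ x ≠ v')
      (fun u x hu hux hx => hcl u x hu hux hx.1 hx.2.1 hx.2.2) (hadjH _ hθ) W hvS fun x hx => Or.inr ?_)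
    have hcx : (openGraph θ).Reachable c x := hcv.trans (hθwalk W x hx)
    exact ⟨fun h => hac (by rw [hθa c (h ▸ hcx).symm]), fun h => hbc' (by rw [← h]; exact hcx.symm),
      fun h => hbc' (hbv'.trans (by rw [← h]; exact hcx.symm))⟩
  · -- `v' ∤ c` off `{a, b, v}`: contradicted by the `ω`-walk from `v'` to `c` inside `C_c(ω)`
    obtain ⟨W⟩ := hcv'.symm
    refine hcS (mem_of_openWalk_adm H S (fun x => x ≠ a ∧ x ≠ b ∧ x ≠ v)
      (fun u x hu hux hx => hcl u x hu hux hx.1 hx.2.1 hx.2.2) (hadjH ω hω) W hvS fun x hx => Or.inr ?_)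
    have hcx : (openGraph ω).Reachable c x := hcv'.trans (hωwalk W x hx)
    exact ⟨fun h => hac (by rw [← h]; exact hcx.symm), fun h => hbc (by rw [← h]; exact hcx.symm),
      fun h => hbc (hbv.trans (by rw [← h]; exact hcx.symm))⟩
  · -- `v' ∤ b` off `{a, c, v}`: contradicted by the `θ`-walk from `v'` to `b` inside `C_b(θ)`
    obtain ⟨W⟩ := hbv'.symm
    refine hbS (mem_of_openWalk_adm H S (fun x => x ≠ a ∧ x ≠ c ∧ x ≠ v)
      (fun u x hu hux hx => hcl u x hu hux hx.1 hx.2.1 hx.2.2) (hadjH _ hθ) W hvS fun x hx => Or.inr ?_)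
    have hbx : (openGraph θ).Reachable b x := hbv'.trans (hθwalk W x hx)
    exact ⟨fun h => hab (by rw [hθa b (h ▸ hbx).symm]), fun h => hbc' (by rw [← h]; exact hbx),
      fun h => hbc' (hbx.trans (by rw [h]; exact hcv.symm))⟩

/-- **No double clash when `R_a ∩ R_b ∩ R_c` has at most one branch vertex** (special case of
`Consts.not_doubleClash_of_separated`). [folklore; input for Gladkov2024, Thm. 4.3] -/
theorem not_doubleClash_of_oneBranch (H : SimpleGraph V) [DecidableRel H.Adj] (w : Sym2 V → unitInterval) {a b c : V}
    (hH : ∀ u v, u ≠ v → (0 : ℝ) < w s(u, v) → H.Adj u v) (Ra Rb Rc : Set V) (haR : a ∈ Ra) (hbR : b ∈ Rb) (hcR : c ∈ Rc)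
    (hRa : ∀ u v, u ∈ Ra → H.Adj u v → v ≠ a → v ≠ b → v ≠ c → v ∈ Ra)
    (hRb : ∀ u v, u ∈ Rb → H.Adj u v → v ≠ a → v ≠ b → v ≠ c → v ∈ Rb)
    (hRc : ∀ u v, u ∈ Rc → H.Adj u v → v ≠ a → v ≠ b → v ≠ c → v ∈ Rc)
    (hone : ∀ v v', v ∈ Ra → v ∈ Rb → v ∈ Rc → v' ∈ Ra → v' ∈ Rb → v' ∈ Rc → v ≠ a → v ≠ b → v ≠ c →
      v' ≠ a → v' ≠ b → v' ≠ c → 3 ≤ H.degree v → 3 ≤ H.degree v' → v = v')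
    {ω η : Set (Sym2 V)} (hω : ∀ e ∈ ω, (0 : ℝ) < w e) (hη : ∀ e ∈ η, (0 : ℝ) < w e)
    (hab : ¬ (openGraph ω).Reachable a b) (hac : ¬ (openGraph ω).Reachable a c) (hbc : ¬ (openGraph ω).Reachable b c)
    (hbc' : ¬ (openGraph (η \ barOf {a} (setCl ω {a}))).Reachable b c) :
    ¬ ((∃ y k : V, (openGraph ω).Reachable a k ∧ (0 : ℝ) < w s(k, y) ∧ (openGraph ω).Reachable b y ∧
          (openGraph (η \ barOf {a} (setCl ω {a}))).Reachable c y) ∧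
       (∃ y k : V, (openGraph ω).Reachable a k ∧ (0 : ℝ) < w s(k, y) ∧ (openGraph ω).Reachable c y ∧
          (openGraph (η \ barOf {a} (setCl ω {a}))).Reachable b y)) :=
  not_doubleClash_of_separated H w hH Ra Rb Rc haR hbR hcR hRa hRb hRc
    (fun v v' h1 h2 h3 h4 h5 h6 h7 h8 h9 h10 h11 h12 hne hd hd' =>
      absurd (hone v v' h1 h2 h3 h4 h5 h6 h7 h8 h9 h10 h11 h12 hd hd') hne) hω hη hab hac hbc hbc'

end General

end Consts

end Summit.CriticalPhenomena.PercolationContinuityZ3.Theorems
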